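import Literature.AlgebraicGeometry.Resolution.MarkedIdealsLemmas
import Literature.AlgebraicGeometry.Resolution.RegularWeakTransformPrime
import Mathlib.AlgebraicGeometry.IdealSheaf.Functorial
import Mathlib.AlgebraicGeometry.Noetherian
import HarnessLib

/-!
# The support of a saturation `⨆ₙ (K : Jⁿ)` is the closure of `V(K) ∖ V(J)`; the support of the schematic strict transform

Topic: `Literature/AlgebraicGeometry/Resolution`. Theorem-only file (sorry-free, no definitions, no named facts); the
(B)⇒(A) support bridge requested by chain W5.2 (res-L1-w52-plan-1 G11-50 (3); typed by res-L1-s13-pv-1 g7, custody DEAL #42).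

For a locally Noetherian scheme `X` and ideal sheaves `K`, `J`:

* `support_iSup_colon_pow_eq_closure` — **`supp (⨆ₙ (K : Jⁿ)) = closure (supp K ∖ supp J)`**.  Proof through Mathlib's global
  Galois connection `support ⊣ vanishingIdeal` (`Scheme.IdealSheafData.gc`): (⊇) every section of `(K : Jⁿ)` over an affine open
  `U` vanishes at the primes of `Γ(U)` containing `K(U)` but not `J(U)` (`mem_of_mem_colon_pow`); (⊆) a section `f` vanishing on
  `V(K(U)) ∖ V(J(U))` has `f·J(U) ⊆ √K(U)`, so `(f·J(U))ᴺ ⊆ K(U)` for some `N` (`Γ(U)` Noetherian,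
  `Ideal.exists_pow_le_of_le_radical_of_fg`) and `fᴺ ∈ (K(U) : J(U)ᴺ)` (`exists_pow_mem_colon_pow_of_mem_vanishingIdeal_diff`), whence
  `vanishingIdeal (closure …) ≤ √(⨆ₙ (K : Jⁿ))`.  Sections of the colon sheaf are the sectionwise colon on a locally Noetherian scheme
  (tree `ideal_colon`, Atiyah–Macdonald 3.15).
* `support_strictTransformIdeal_eq_closure` — for ANY morphism `τ : X' → X` with `X'` locally Noetherian and ideal sheaves `C`, `K`
  on `X`: **`supp (strictTransformIdeal τ C K) = closure (τ⁻¹(supp K ∖ supp C))`** (`strictTransformIdeal τ C K = ⨆ₙ (τ^*K : (τ^*C)ⁿ)`,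
  tree `MarkedIdeals`; Görtz–Wedhorn I (13.19): the strict transform «can also be described as the schematic closure of
  `π⁻¹(Y ∖ Z)`» — here its underlying closed SET); `IsBlowup.support_strictTransformIdeal_eq_closure` is the same with the
  (unused) blow-up hypothesis in the signature, for drop-in use.
* `IsBlowup.support_controlledTransform_one_eq_closure_of_isRegular` — for a blow-up `π` of a regular locally Noetherian `X` in a
  regular centre `V(C)` and `H ≤ C` with `V(H)` regular, the weak transform `(π^*H : 𝓘(D))` has support
  `closure (π⁻¹(supp H ∖ supp C))` (previous item + tree `IsBlowup.strictTransformIdeal_eq_controlledTransform_of_isRegular_subscheme`).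

Related tree statements NOT restated: `IsBlowup.preimage_closure_diff_support_subset` (`StrictTransformClosedSetPieces`),
`support_strictTransformIdeal_subset` (`MaximalContactPersistence`, the inclusion `supp St(H) ⊆ supp (π^*H : 𝓘(D))`).
The same set equality for the strict transform was obtained chain-side in `Summits/…/EquisingularLiftEquisingularLiftNatStrictTransformSupport`
(res-L1-w45b) by an affine-local argument; this Literature file gives the general saturation statement and a different proof.

References: U. Görtz, T. Wedhorn, *Algebraic Geometry I*, 2nd ed. (2020), (13.19) p. 414 [GortzWedhorn2020];
M. F. Atiyah, I. G. Macdonald, *Introduction to Commutative Algebra* (1969), Prop. 1.14, Cor. 3.15, Ex. 1.18 [AtiyahMacdonald1969].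
AI bookkeeping weaker than expert review.
-/

noncomputable section

open CategoryTheory AlgebraicGeometry TopologicalSpace Topology

namespace Literature.AlgebraicGeometry.Resolution

universe u

open Scheme.IdealSheafData

/-! ## § 1 Ring level: saturations and the vanishing ideal of `V(K) ∖ V(J)` -/

/-- If `f ∈ (K : Jⁿ)` and the prime `𝔭` contains `K` but not `J`, then `f ∈ 𝔭`. [cite: AtiyahMacdonald1969, Ex. 1.12 / Prop. 1.11] -/
theorem mem_of_mem_colon_pow {A : Type*} [CommRing A] {K J : Ideal A} {n : ℕ} {f : A}
    (hf : f ∈ K.colon ((J ^ n : Ideal A) : Set A)) {p : PrimeSpectrum A}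
    (hK : p ∈ PrimeSpectrum.zeroLocus (K : Set A)) (hJ : p ∉ PrimeSpectrum.zeroLocus (J : Set A)) : f ∈ p.asIdeal := by
  rw [PrimeSpectrum.mem_zeroLocus, SetLike.coe_subset_coe] at hK hJ
  obtain ⟨j, hjJ, hjp⟩ := Set.not_subset.mp hJ
  have hjn : j ^ n ∈ J ^ n := Ideal.pow_mem_pow hjJ n
  have hfj : f * j ^ n ∈ K := by
    have := (Submodule.mem_colon).mp hf (j ^ n) hjn
    simpa [smul_eq_mul] using this
  rcases p.2.mem_or_mem (hK hfj) with h | h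
  · exact h
  · exact absurd (p.2.mem_of_pow_mem n h) hjp

/-- **Saturation detects the vanishing ideal of `V(K) ∖ V(J)`** (Noetherian ring): if `f` vanishes at every prime containing
`K` but not `J`, then `fᴺ ∈ (K : Jᴺ)` for some `N` — because `f·J ⊆ √K` and `f·J` is finitely generated.
[cite: AtiyahMacdonald1969, Prop. 1.14 and Cor. 7.16 (powers of the radical in a Noetherian ring)] -/
theorem exists_pow_mem_colon_pow_of_mem_vanishingIdeal_diff {A : Type*} [CommRing A] [IsNoetherianRing A]
    (K J : Ideal A) {f : A}
    (hf : f ∈ PrimeSpectrum.vanishingIdeal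
      (PrimeSpectrum.zeroLocus (K : Set A) \ PrimeSpectrum.zeroLocus (J : Set A))) :
    ∃ N : ℕ, f ^ N ∈ K.colon ((J ^ N : Ideal A) : Set A) := by
  -- `(f)·J ≤ √K`
  have h1 : Ideal.span {f} * J ≤ K.radical := by
    rw [← PrimeSpectrum.vanishingIdeal_zeroLocus_eq_radical]
    intro g hg
    rw [PrimeSpectrum.mem_vanishingIdeal]
    intro p hp
    by_cases hJ : p ∈ PrimeSpectrum.zeroLocus (J : Set A)
    · rw [PrimeSpectrum.mem_zeroLocus, SetLike.coe_subset_coe] at hJ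
      exact hJ (Ideal.mul_le_left hg)
    · have hfp : f ∈ p.asIdeal := (PrimeSpectrum.mem_vanishingIdeal _ _).mp hf p ⟨hp, hJ⟩
      exact (Ideal.span_singleton_le_iff_mem _ |>.mpr hfp) (Ideal.mul_le_right hg)
  obtain ⟨N, hN⟩ := Ideal.exists_pow_le_of_le_radical_of_fg h1 (IsNoetherian.noetherian _)
  refine ⟨N, Submodule.mem_colon.mpr fun s hs => ?_⟩
  rw [smul_eq_mul]
  apply hN
  rw [mul_pow, Ideal.span_singleton_pow]
  exact Ideal.mul_mem_mul (Ideal.mem_span_singleton_self _) hs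

/-! ## § 2 Points of an affine open as primes -/

set_option backward.isDefEq.respectTransparency false in
/-- On an affine open `U`, the point `fromSpec 𝔭` lies in `supp I` iff `𝔭 ⊇ I(U)` (private plumbing). [folklore] -/
private theorem fromSpec_mem_support_iff {X : Scheme.{u}} (I : X.IdealSheafData) (U : X.affineOpens)
    (p : PrimeSpectrum Γ(X, U)) :
    U.2.fromSpec p ∈ (I.support : Set X) ↔ p ∈ PrimeSpectrum.zeroLocus (I.ideal U : Set Γ(X, U)) := by
  have hxU : U.2.fromSpec p ∈ (U : X.Opens) := by
    have h := Set.mem_range_self (f := fun q => U.2.fromSpec q) p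
    rwa [U.2.range_fromSpec] at h
  rw [SetLike.mem_coe, mem_support_iff_of_mem (I := I) hxU, ← Set.mem_preimage, U.2.fromSpec_preimage_zeroLocus]

/-! ## § 3 The support of a saturation -/

set_option backward.isDefEq.respectTransparency false in
/-- **`supp (⨆ₙ (K : Jⁿ)) = closure (supp K ∖ supp J)`** on a locally Noetherian scheme.
[cite: AtiyahMacdonald1969, Cor. 3.15 (colons commute with localization) and Prop. 1.14; GortzWedhorn2020, (13.19)] -/
theorem support_iSup_colon_pow_eq_closure {X : Scheme.{u}} [IsLocallyNoetherian X] (K J : X.IdealSheafData) :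
    ((⨆ n : ℕ, colon K (J ^ n)).support : Set X) = closure ((K.support : Set X) \ (J.support : Set X)) := by
  set S : Set X := (K.support : Set X) \ (J.support : Set X) with hS
  set Z : Closeds X := ⟨closure S, isClosed_closure⟩ with hZ
  apply le_antisymm
  · -- `supp ⊆ closure S`: `vanishingIdeal Z ≤ √(⨆ₙ (K : Jⁿ))`
    have h : vanishingIdeal Z ≤ (⨆ n : ℕ, colon K (J ^ n)).radical := by
      intro U f hf
      rw [vanishingIdeal_ideal] at hf
      rw [radical_ideal]
      haveI : IsNoetherianRing Γ(X, U) := IsLocallyNoetherian.component_noetherian U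
      have hf' : f ∈ PrimeSpectrum.vanishingIdeal (PrimeSpectrum.zeroLocus (K.ideal U : Set Γ(X, U)) \
          PrimeSpectrum.zeroLocus (J.ideal U : Set Γ(X, U))) := by
        refine PrimeSpectrum.vanishingIdeal_anti_mono ?_ hf
        rintro p ⟨hpK, hpJ⟩
        change U.2.fromSpec p ∈ (Z : Set X)
        exact subset_closure ⟨(fromSpec_mem_support_iff K U p).mpr hpK,
          fun h => hpJ ((fromSpec_mem_support_iff J U p).mp h)⟩
      obtain ⟨N, hN⟩ := exists_pow_mem_colon_pow_of_mem_vanishingIdeal_diff (K.ideal U) (J.ideal U) hf'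
      refine ⟨N, ?_⟩
      have hle : colon K (J ^ N) ≤ ⨆ n : ℕ, colon K (J ^ n) := le_iSup (fun n : ℕ => colon K (J ^ n)) N
      apply hle U
      rw [ideal_colon, Scheme.IdealSheafData.ideal_pow, Pi.pow_apply]
      exact hN
    calc ((⨆ n : ℕ, colon K (J ^ n)).support : Set X)
        = (((⨆ n : ℕ, colon K (J ^ n)).radical).support : Set X) := by rw [support_radical]
      _ ⊆ ((vanishingIdeal Z).support : Set X) := support_antitone h
      _ = Z := by rw [coe_support_vanishingIdeal]
  · -- `closure S ⊆ supp`: `⨆ₙ (K : Jⁿ) ≤ vanishingIdeal Z`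
    have h : (⨆ n : ℕ, colon K (J ^ n)) ≤ vanishingIdeal Z := by
      refine iSup_le fun n U f hf => ?_
      haveI : IsNoetherianRing Γ(X, U) := IsLocallyNoetherian.component_noetherian U
      rw [vanishingIdeal_ideal, PrimeSpectrum.mem_vanishingIdeal]
      rw [ideal_colon, Scheme.IdealSheafData.ideal_pow, Pi.pow_apply] at hf
      -- the primes under `S ∩ U` kill `f`; that set of primes is closed under closure in `Spec Γ(U)`
      have hT : U.2.fromSpec ⁻¹' S ⊆ PrimeSpectrum.zeroLocus {f} := by
        rintro p ⟨hpK, hpJ⟩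
        have hfp : f ∈ p.asIdeal := mem_of_mem_colon_pow hf ((fromSpec_mem_support_iff K U p).mp hpK)
          (fun h => hpJ ((fromSpec_mem_support_iff J U p).mpr h))
        change ({f} : Set Γ(X, U)) ⊆ (p.asIdeal : Set Γ(X, U))
        exact Set.singleton_subset_iff.mpr hfp
      intro p hp
      change p ∈ U.2.fromSpec ⁻¹' closure S at hp
      rw [U.2.fromSpec.isOpenEmbedding.isOpenMap.preimage_closure_eq_closure_preimage U.2.fromSpec.continuous] at hp
      have hmem : ({f} : Set Γ(X, U)) ⊆ (p.asIdeal : Set Γ(X, U)) :=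
        (PrimeSpectrum.isClosed_zeroLocus {f}).closure_subset_iff.mpr hT hp
      exact Set.singleton_subset_iff.mp hmem
    have hZ' : Z ≤ (⨆ n : ℕ, colon K (J ^ n)).support := le_support_iff_le_vanishingIdeal.mpr h
    exact hZ'

/-! ## § 4 The support of the schematic strict transform -/

/-- **`supp (strictTransformIdeal τ C K) = closure (τ⁻¹(supp K ∖ supp C))`** for any morphism `τ : X' → X` with `X'` locally
Noetherian: the closed set underlying the schematic strict transform `⨆ₙ (τ^*K : (τ^*C)ⁿ)` is the topological strict transform.
[cite: GortzWedhorn2020, (13.19) p. 414] -/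
theorem support_strictTransformIdeal_eq_closure {X X' : Scheme.{u}} [IsLocallyNoetherian X'] (τ : X' ⟶ X)
    (C K : X.IdealSheafData) :
    ((strictTransformIdeal τ C K).support : Set X') = closure (τ ⁻¹' ((K.support : Set X) \ (C.support : Set X))) := by
  rw [strictTransformIdeal, support_iSup_colon_pow_eq_closure, Scheme.IdealSheafData.support_comap,
    Scheme.IdealSheafData.support_comap]
  rfl

/-- The same, with the blow-up hypothesis in the signature (drop-in form for blow-up sequences).
[cite: GortzWedhorn2020, (13.19) p. 414] -/
theorem IsBlowup.support_strictTransformIdeal_eq_closure {X X' : Scheme.{u}} [IsLocallyNoetherian X'] {π : X' ⟶ X}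
    {C : X.IdealSheafData} (_hπ : IsBlowup π C) (K : X.IdealSheafData) :
    ((strictTransformIdeal π C K).support : Set X') = closure (π ⁻¹' ((K.support : Set X) \ (C.support : Set X))) :=
  Literature.AlgebraicGeometry.Resolution.support_strictTransformIdeal_eq_closure π C K

/-- **Regular centre inside a regular subscheme of a regular scheme**: the weak transform `(π^*H : 𝓘(D))` of `V(H)` under the
blow-up `π` along `V(C) ⊆ V(H)` has support `closure (π⁻¹(supp H ∖ supp C))` — it IS the strict transform ideal there
(tree `IsBlowup.strictTransformIdeal_eq_controlledTransform_of_isRegular_subscheme`).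
[cite: GortzWedhorn2020, (13.19) and Prop. 13.96 (2), p. 416] -/
theorem IsBlowup.support_controlledTransform_one_eq_closure_of_isRegular {X X' : Scheme.{u}} [IsLocallyNoetherian X]
    [IsLocallyNoetherian X'] {π : X' ⟶ X} {C H : X.IdealSheafData} (hX : Scheme.IsRegular X) (hπ : IsBlowup π C)
    (hC : Scheme.IsRegular C.subscheme) (hHC : H ≤ C) (hH : Scheme.IsRegular H.subscheme) :
    ((controlledTransform π C H 1).support : Set X') = closure (π ⁻¹' ((H.support : Set X) \ (C.support : Set X))) := by
  rw [← hπ.strictTransformIdeal_eq_controlledTransform_of_isRegular_subscheme hX hC hHC hH]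
  exact Literature.AlgebraicGeometry.Resolution.support_strictTransformIdeal_eq_closure π C H

end Literature.AlgebraicGeometry.Resolution

end
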